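import Mathlib
import Summits.AtomisticToContinuum.Crystallization.Theses.SquareWellLayerCake
import Literature.Geometry.DiscreteGeometry.KissingPatterns

/-!
# Sketch — crux-ideate (ideator 2, round 1) for `GapTwelveToBarlow` (stmt-AtomisticToContinuum-15807)

First lemmas of the two idea cards `cbb-curvature-ration` and `tolerant-l12-trichotomy`, typed over
existing declarations.  Nothing is proved here; every `def` is a `Prop`.
-/

noncomputable section

namespace Summit.AtomisticToContinuum.Crystallization.Cruxes.GapTwelveToBarlow.IdeatorTwo

open Literature.MathematicalPhysics.StatisticalMechanics
open Literature.Geometry.DiscreteGeometry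

local notation "E3" => EuclideanSpace ℝ (Fin 3)

/-- K3's sitewise predicate, verbatim from `SquareWellLayerCake.GapTwelveToBarlow`: the
`11/10`-neighbourhood of `i` is `55/57`-separated, exactly twelve others lie within `1`, at most
twelve within `11/10` (so the shell `(1, 11/10]` is empty). -/
def GoodAt {N : ℕ} (x : Fin N → E3) (i : Fin N) : Prop :=
  (∀ j : Fin N, dist (x i) (x j) ≤ 11 / 10 → ∀ k : Fin N, k ≠ j → (55 : ℝ) / 57 ≤ dist (x j) (x k)) ∧
  (Finset.univ.filter fun j : Fin N => j ≠ i ∧ dist (x i) (x j) ≤ 1).card = 12 ∧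
  (Finset.univ.filter fun j : Fin N => j ≠ i ∧ dist (x i) (x j) ≤ 11 / 10).card ≤ 12

/-- Good two shells deep: `i` and every particle within `11/10` of it are Good. In an a.e.-Good
ground state all but `o(N)` particles are two-deep Good (Good particles are `55/57`-separated, so each
non-Good particle spoils at most `C` Good ones). -/
def TwoDeepGood {N : ℕ} (x : Fin N → E3) (i : Fin N) : Prop :=
  GoodAt x i ∧ ∀ j : Fin N, dist (x i) (x j) ≤ 11 / 10 → GoodAt x j

/-- Common neighbours (the RING) of the pair `i, j`. -/
def commonNbrs {N : ℕ} (x : Fin N → E3) (i j : Fin N) : Finset (Fin N) :=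
  Finset.univ.filter fun k : Fin N => k ≠ i ∧ k ≠ j ∧ dist (x i) (x k) ≤ 1 ∧ dist (x j) (x k) ≤ 1

/-- Number of bonded pairs inside the ring of `i, j` (`T`-wedges). -/
def ringBonds {N : ℕ} (x : Fin N → E3) (i j : Fin N) : ℕ :=
  ((commonNbrs x i j ×ˢ commonNbrs x i j).filter fun p : Fin N × Fin N =>
    p.1 < p.2 ∧ dist (x p.1) (x p.2) ≤ 1).card

/-- A FIVE-FOLD BOND: a bond whose ring has five members (the decahedral-axis edge, deficit
`2π − 5 arccos(1/3) = 0.12838`). -/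
def IsFiveFoldBond {N : ℕ} (x : Fin N → E3) (i j : Fin N) : Prop :=
  i ≠ j ∧ dist (x i) (x j) ≤ 1 ∧ (commonNbrs x i j).card = 5

/-- **RING CENSUS** (shared finite gate of both lines; decidable by interval arithmetic / branch and
bound on ≤ 21-point configurations): around a bond of a two-deep-Good pair the ring word is the flat
`(2,2)` (four common neighbours, two bonded ring pairs: `TOTO` or `TTOO`) or the positively curved
`(5,0)` (five common neighbours, all five consecutive ring pairs bonded); in particular no negatively
curved word (`(4,1)`, `(1,3)`, `(6,0)`, …) closes at bond window `[55/57, 1]` with the empty shell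
`(1, 11/10]`.  Numerical census: kit jobs j020167 / j020304 (this session). -/
def RingCensus : Prop :=
  ∀ (N : ℕ) (x : Fin N → E3) (i j : Fin N), i ≠ j → TwoDeepGood x i → TwoDeepGood x j →
    dist (x i) (x j) ≤ 1 →
      ((commonNbrs x i j).card = 4 ∧ ringBonds x i j = 2) ∨
      ((commonNbrs x i j).card = 5 ∧ ringBonds x i j = 5)

/-- **TOLERANT LEMMA 2** (the decisive finite sub-question found by the census, Hales 2012 Lemma 2 with
slack): a particle that is not a neighbour of a two-deep-Good particle `i` stays at distance `≥ 13/10` from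
it — equivalently (up to constants) every face of the shell graph of `i` is a triangle or a quadrilateral, so
the only holes over Good material are tetrahedra and octahedral halves.  At `η = 0` the constant is Hales's
`h₀·… = 1.26`; the kit job gap13 (Part D) calibrates it at window `[55/57, 1]`.  With it, consecutive
non-bonded common neighbours of a bond are `≥ 13/10` apart, which kills the "broken five-rings" (a ring pair
at `1.10–1.16`) that the two-shell model admits. -/
def TolerantLemmaTwo : Prop :=
  ∀ (N : ℕ) (x : Fin N → E3) (i j : Fin N), TwoDeepGood x i → 1 < dist (x i) (x j) →
    (13 : ℝ) / 10 ≤ dist (x i) (x j)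

/-- **OCTAHEDRAL COMPLETION** (hole census, companion of `RingCensus`; same finite certificate): every
`O`-wedge of a two-deep-Good bond — two common neighbours `k, l` at distance in `(1, 3/2]`, i.e. `≈ √2` —
is the waist of a genuine octahedron: there are particles `i', j'` opposite `i, j` bonded to the other four
vertices and to each other.  With `RingCensus` this makes the holes around Good material exactly tetrahedra
and octahedra with all edges bonds, so the regular-cell re-metrisation of line `cbb-curvature-ration` is
well defined. -/
def OctahedralCompletion : Prop :=
  ∀ (N : ℕ) (x : Fin N → E3) (i j k l : Fin N), i ≠ j → TwoDeepGood x i → TwoDeepGood x j →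
    dist (x i) (x j) ≤ 1 → k ∈ commonNbrs x i j → l ∈ commonNbrs x i j →
    1 < dist (x k) (x l) → dist (x k) (x l) ≤ 3 / 2 →
      ∃ i' j' : Fin N, dist (x i') (x j) ≤ 1 ∧ dist (x i') (x k) ≤ 1 ∧ dist (x i') (x l) ≤ 1 ∧
        dist (x j') (x i) ≤ 1 ∧ dist (x j') (x k) ≤ 1 ∧ dist (x j') (x l) ≤ 1 ∧
        dist (x i') (x j') ≤ 1 ∧ 1 < dist (x i') (x i) ∧ 1 < dist (x j') (x j)

/-- **CURVATURE RATION** (line `cbb-curvature-ration`, its load-bearing stub in K3's own finite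
language): there is a universal `C` such that in any configuration that is two-deep Good on the ball
`B(c, 4r)`, the number of five-fold bonds with an endpoint in `B(c, r)` is at most `C · r` — linear,
not cubic, in `r` (Petrunin's bound `∫_{B_r} Sc ≤ C(3)·r` for curvature `≥ 0`, read on the
regular-cell re-metrisation of the tetrahedron–octahedron complex, whose Regge scalar curvature is
`0.12838 ×` five-fold bond length). -/
def CurvatureRation : Prop :=
  ∃ C : ℝ, ∀ (N : ℕ) (x : Fin N → E3) (c : E3) (r : ℝ), 1 ≤ r →
    (∀ i : Fin N, dist (x i) c ≤ 4 * r → TwoDeepGood x i) →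
      (Nat.card {p : Fin N × Fin N // IsFiveFoldBond x p.1 p.2 ∧ dist (x p.1) c ≤ r} : ℝ) ≤ C * r

/-- **FIVE-FOLD SPARSITY** (what both lines hand to the metric half; pure geometry, no minimality):
under K3's hypothesis the particles lying on a five-fold bond have density zero. -/
def FiveFoldSparse : Prop :=
  ∀ x : (N : ℕ) → (Fin N → E3),
    Filter.Tendsto (fun N : ℕ => (Nat.card {i : Fin N // ¬ GoodAt (x N) i} : ℝ) / N)
      Filter.atTop (nhds 0) →
    Filter.Tendsto (fun N : ℕ => (Nat.card {i : Fin N // ∃ j : Fin N, IsFiveFoldBond (x N) i j} : ℝ) / N)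
      Filter.atTop (nhds 0)

/-- The twelve-point DECAHEDRAL-AXIS pattern `D₅ₕ` (two poles, two aligned pentagonal rings of
radius `√3/2` at heights `±1/2`; in-ring chord `√3·sin 36° = 1.018`), as in route DisclinationRation. -/
def d5hPattern : Finset E3 :=
  ({!₂[(0 : ℝ), 0, 1], !₂[(0 : ℝ), 0, -1]} : Finset E3) ∪
    (Finset.univ.image fun k : Fin 5 =>
      !₂[Real.sqrt 3 / 2 * Real.cos (2 * Real.pi * (k : ℝ) / 5),
        Real.sqrt 3 / 2 * Real.sin (2 * Real.pi * (k : ℝ) / 5), (1 : ℝ) / 2]) ∪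
    (Finset.univ.image fun k : Fin 5 =>
      !₂[Real.sqrt 3 / 2 * Real.cos (2 * Real.pi * (k : ℝ) / 5),
        Real.sqrt 3 / 2 * Real.sin (2 * Real.pi * (k : ℝ) / 5), -(1 : ℝ) / 2])

/-- **SHELL TRICHOTOMY** (line `tolerant-l12-trichotomy`, its load-bearing finite certificate —
"tolerant `L12`" at bond spread `57/55 = 1.0364` with gap ratio `1.14`): the twelve neighbours of a
two-deep-Good particle, recentred, are `1/20`-close after a linear isometry to the cuboctahedron, the
anticuboctahedron or the decahedral-axis pattern (no rescaling needed: bond lengths are already in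
`[0.9649, 1]`). -/
def ShellTrichotomy : Prop :=
  ∀ (N : ℕ) (x : Fin N → E3) (i : Fin N), TwoDeepGood x i →
    ∃ (A : E3 →ₗᵢ[ℝ] E3) (P : Finset E3),
      (P = fccKissingPattern ∨ P = hcpKissingPattern ∨ P = d5hPattern) ∧
      (∀ j : Fin N, j ≠ i → dist (x i) (x j) ≤ 1 → ∃ p ∈ P, dist (x j - x i) (A p) ≤ 1 / 20) ∧
      (∀ p ∈ P, ∃ j : Fin N, j ≠ i ∧ dist (x i) (x j) ≤ 1 ∧ dist (x j - x i) (A p) ≤ 1 / 20)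

/-- **AXIS STRAIGHTNESS** (consequence of the trichotomy used by line `tolerant-l12-trichotomy`):
five-fold bonds at a two-deep-Good particle come in antipodal pairs — a five-fold axis never ends or
bends inside Good material (poles of the `D₅ₕ` shell are antipodal; cubo/anticubo shells carry none). -/
def AxisStraightness : Prop :=
  ∀ (N : ℕ) (x : Fin N → E3) (i j : Fin N), TwoDeepGood x i → IsFiveFoldBond x i j →
    ∃ k : Fin N, k ≠ j ∧ IsFiveFoldBond x i k ∧ dist (x j + x k - 2 • x i) 0 ≤ 1 / 10 ∧
      ∀ l : Fin N, IsFiveFoldBond x i l → l = j ∨ l = k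

end Summit.AtomisticToContinuum.Crystallization.Cruxes.GapTwelveToBarlow.IdeatorTwo
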